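import Literature.NumberTheory.Irrationality.RhinViola2001.ThetaInvarianceProofs
import HarnessLib

/-!
# Rhin–Viola 2001, §2 p. 272: the `ϑ`-invariance of the triple integrals — the form in `ℝ₊ ∪ {∞}`

Topic `Literature/NumberTheory/Irrationality/RhinViola2001`. PROOFS ONLY (no definition, no statement). Companion of
`ThetaInvarianceProofs.lean` (cell `pub-zeta5`, seat ct-1 g29), which proves `ThetaInvariance.I_theta : P.Balanced → I (ϑP) = I P`
for the Bochner integrals `I(h,j,k,l,m,q,r,s)` of (2.1). Source: G. Rhin, C. Viola, *The group structure for ζ(3)*, Acta Arith. **97**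
(2001) 269–293 [RhinViola2001], §2 p. 272: "if we make in (2.1) the change of variables `ϑ⁻¹` … by virtue of (2.2), (2.3), (2.4)
and (2.5) we obtain the integral `I(j,k,l,m,q,r,s,h)`."

This file records the SAME change of variables for the LOWER LEBESGUE INTEGRALS
`∫⁻_{(0,1)³} (integrand P)⁺` (values in `ℝ₊ ∪ {∞}`): `ThetaInvariance.lintegral_theta`. The point: the lower integral is the object
in which DIVERGENT members of the family still carry information (`∞`), and the identity holds there verbatim, for every balanced
`P` — this is the form consumed by the `n = 3` case of Fischler's Théorème 3.2 (`Fischler2002/Theoreme32Three*.lean`), whose family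
`𝒥₃` on `𝓔₃` is Rhin–Viola's family read as lower integrals. Proof: Mathlib's `lintegral_image_eq_lintegral_abs_det_fderiv_mul` for the
injective differentiable map `ϑ⁻¹` of `(0,1)³` onto itself, with ct-1 g29's pointwise lemmas (`thetaInv_image`, `thetaInv_injOn`,
`hasFDerivAt_thetaInv`, `integrand_thetaInv`). Cell `pub-zeta5`, seat ct-1 g34, 2026-08-28.

HONEST FRAMING (cell pub-zeta5): systematic search; no irrationality claim unless certified — an identity between (possibly infinite)
integrals of non-negative functions; nothing about `ζ(3)`'s or `ζ(5)`'s arithmetic.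
-/

noncomputable section

namespace Literature.NumberTheory.Irrationality.RhinViola2001

open MeasureTheory Set
open scoped ENNReal

namespace ThetaInvariance

/-- **`ϑ`-invariance in `ℝ₊ ∪ {∞}`:** for every balanced `P` ((2.2) `h+m = k+r`, (2.3) `j+q = l+s`),
`∫⁻_{(0,1)³} (integrand (ϑP))⁺ = ∫⁻_{(0,1)³} (integrand P)⁺` — the change of variables `ϑ⁻¹` (2.6) in the lower Lebesgue integral
(no sign and no convergence hypothesis). [cite: RhinViola2001, §2 p. 272 ((2.4)–(2.6))] -/
theorem lintegral_theta (P : Params) (hB : P.Balanced) :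
    ∫⁻ p in cube, ENNReal.ofReal (integrand (theta P) p) = ∫⁻ p in cube, ENNReal.ofReal (integrand P p) := by
  -- a derivative at every point (junk `0` off the cube, where nothing is claimed)
  have hex : ∀ p : Fin 3 → ℝ, ∃ f' : (Fin 3 → ℝ) →L[ℝ] (Fin 3 → ℝ), p ∈ cube →
      HasFDerivAt (fun p : Fin 3 → ℝ => ![(1 - p 1) * (1 - p 2) / (1 - (1 - p 0 * p 1) * p 2), (1 - p 0) * p 2,
        p 0 / (1 - (1 - p 0) * p 2)]) f' p ∧
      f'.det = -((1 - p 0) * (1 - p 2)) / (1 - (1 - p 0 * p 1) * p 2) ^ 2 := by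
    intro p
    by_cases hp : p ∈ cube
    · obtain ⟨f', hf'⟩ := hasFDerivAt_thetaInv p
        (aux_D (hp 0).1 (hp 0).2 (hp 1).1 (hp 1).2 (hp 2).1 (hp 2).2).1.ne'
        (aux_W (hp 0).1 (hp 0).2 (hp 2).1 (hp 2).2).1.ne'
      exact ⟨f', fun _ => hf'⟩
    · exact ⟨0, fun h => (hp h).elim⟩
  choose f' hf' using hex
  have hderiv : ∀ p ∈ cube, HasFDerivWithinAt (fun p : Fin 3 → ℝ => ![(1 - p 1) * (1 - p 2) / (1 - (1 - p 0 * p 1) * p 2),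
      (1 - p 0) * p 2, p 0 / (1 - (1 - p 0) * p 2)]) (f' p) cube p := fun p hp =>
    (hf' p hp).1.hasFDerivWithinAt
  have hcv := lintegral_image_eq_lintegral_abs_det_fderiv_mul volume measurableSet_cube hderiv thetaInv_injOn
    (fun p => ENNReal.ofReal (integrand P p))
  rw [thetaInv_image] at hcv
  rw [hcv]
  refine (setLIntegral_congr_fun measurableSet_cube fun p hp => ?_).symm
  have h0 := hp 0; have h1 := hp 1; have h2 := hp 2
  have hD := (aux_D h0.1 h0.2 h1.1 h1.2 h2.1 h2.2).1
  have hpos : 0 < (1 - p 0) * (1 - p 2) / (1 - (1 - p 0 * p 1) * p 2) ^ 2 :=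
    div_pos (mul_pos (by linarith [h0.2]) (by linarith [h2.2])) (pow_pos hD 2)
  show ENNReal.ofReal |(f' p).det| * ENNReal.ofReal (integrand P _) = ENNReal.ofReal (integrand (theta P) p)
  rw [(hf' p hp).2, neg_div, abs_neg, abs_of_pos hpos, ← ENNReal.ofReal_mul hpos.le, integrand_thetaInv P hB hp]

/-- The same identity for the iterates: `∫⁻ (integrand (ϑ^k P))⁺ = ∫⁻ (integrand P)⁺` for every `k` and every balanced `P`
(`ϑ` preserves (2.2)–(2.3)). [cite: RhinViola2001, §2 p. 272 ((2.4): "ϑ has period 8")] -/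
theorem lintegral_theta_iterate (P : Params) (hB : P.Balanced) (k : ℕ) :
    ∫⁻ p in cube, ENNReal.ofReal (integrand (theta^[k] P) p) = ∫⁻ p in cube, ENNReal.ofReal (integrand P p) := by
  induction k generalizing P with
  | zero => rfl
  | succ k ih =>
    rw [Function.iterate_succ_apply, ih (theta P) (balanced_theta hB), lintegral_theta P hB]

end ThetaInvariance

end Literature.NumberTheory.Irrationality.RhinViola2001

end
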